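import Summits.Schanuel.Schanuel.Theorems.RootDecomp1KArcCell08

/-!
# RootDecomp1KArcCell — lens 1, generation 50, node 9 «THE ARC ENGINE: separation by positive-dimensional containment; members ρ° = Π(1+4^(−k!)) and the twin σ° = Π(1+2·4^(−k!)); item 33364 decided hyp-free at zA = (1, ℓ₂, ρ°), zD = (1, ρ°, σ°) and π-twins» — continuation (RootDecomp1KArcCell09): §9 (A′) the twin product σ° = Π(1+2·4^(−k!))

(lens-1 g50 HOME kernel K = HOME/decomp-schanuel-lens-1/g50/ArcCell.lean 10f1e0d5…, 3410 l · 258 decl lines, imports …RootDecomp1KCollarWall05 + …RootDecomp1KCommonRadixCell04 + …RootDecomp1KNWMeasureHolds BY NAME; P ArcCellProbe.lean af7624ff… rc 0 / C₀ ArcCellCtrl0.lean d71f613e… rc 0 / C ArcCellCtrl.lean 242a3b02… rc 1 = 42 planted; memo NODE-g50.md; CLAIM L2466, EX-ANTE PRICE + CHECKLIST K-g50 L2467, NODE L2469 / REQUEST L2470 (with the lens's ex-post self-correction: both members fall to printed dominance in substance — zA directly by Bundschuh LNM 1415 p.78 / Zhu 推论 1.3.3, zD after τ = σ°/ρ°²);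 critic VERDICT L2473: CLEARED AS PRICED EX ANTE — ONE CELL ×1 «ARC CELL (TYPED-LEVEL)» with the SUBSTANCE CAVEAT OF RECORD (both members inside the archimedean dominance class in substance; E2 convenient, not necessary), RULE K-R39 FIXED, PORT GO. Port by census-1 gen 21 as `RootDecomp1KArcCell01–13` along K's §1–§12 with §4, §7 and §12 cut at decl boundaries by the 400-line file cap: 01 = §1 (E1) `aeval_one_div_two_pow_ne_zero` (dyadic root lemma) + §2 (E2) `toPolyPoly`, `arc_count` (a relation contains ≤ deg q of an injective family of rational arcs — roots over the domain ℚ[X]); 02 = §3 (A) the member: `dfac`, `arcNum`, `arcProdQ` (ρ°_N), `sQ`, `rhoArc` (ρ° = Π(1 + 4^(−k!))) and its tails; 03 = §4a (E3) `TruncGenericSeq` («[class] definition» tag) + **`algebraicIndependent_of_truncGenericSeq`** (the g36/g37 extraction re-plumbed to arbitrary dyadic-type schedules); 04 = §4b `psQ`, the link `truncGeneric_iff_truncGenericSeq` and the tree (X′) re-derived — K's `theorem algebraicIndependent_liouville_of_truncGeneric'` DEMOTED to a documented `example` (its statement is byte-identical to the tree's `RootDecomp1KCommonRadixCell.algebraicIndependent_liouville_of_truncGeneric`,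 CommonRadixCell03 l.98 — dedup twin flagged by the writer L2472 (α), demotion pre-sanctioned by the critic L2473; nothing in K uses the primed name); 05 = §5 the arcs of ρ°: `arcPoly`, `arcF`, `arcBasis`, `arcScal`, `clearArc`, `truncGenericSeq_arc`, tightness `qArc` / `qArc_tight`; 06 = §6 the arc cell `algebraicIndependent_arc_of_mvPolyMeasure`, `algebraicIndependent_rhoArc_ell2`, walls `sb_arcWall3(_pi)`, item-shape instances + §7 head `zA` / `zApi`, `linearIndependent_zA(pi)`, `linLiouville_zA(pi)`; 07 = §7a the ONE 2-adic cut `cutA` + **`form_lower_bound_A`** (exponent 9), `not_hyperLinLiouville_zA(pi)` (m₀ = 10), `sb_zA(pi)`, `finiteOrderLiouvilleSchanuel_at_zA(pi)`, `item33364_at_zA(pi)`, `item31077_at_zA`; 08 = §8 `rhoArc_position` (11 conjuncts by tree name) and its lemmas, `liouville_rhoArc`; 09 = §9 (A′) the twin σ° = Π(1 + 2·4^(−k!)): `arcNum2`, `arcOdd2`, `arcProdQ2`, `sigmaArc`, `liouville_sigmaArc`; 10 = §10 the lines of (ρ°, σ°): `linPoly`, `linF`, `linBasis`, `linScal`, `clearLin`,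 `truncGenericSeq_lin`, `qLin` / `qLin_tight`; 11 = §11 the twin cell `algebraicIndependent_twin_of_mvPolyMeasure`, walls `sb_twinWall3(_pi)`, item-shape instances + §12 head `zD` / `zDpi`, binders; 12 = §12a part 1 the archimedean two-level cut `cutD`, `cutD_succ_ne_zero`, `cutD_height_bound`; 13 = §12a part 2 **`form_lower_bound_D`** (exponent 7), `not_hyperLinLiouville_zD(pi)` (m₀ = 8), `sb_zD(pi)`, `item33364_at_zD(pi)`, `zD_shape`. PORT EDITS (census convention): `set_option linter.dupNamespace false` dropped; 77 one-line helper docstrings added (statements quoted); per-part private helper copies; sections `Extraction` / `Members` / `TwinMembers` closed and re-opened across the cuts with their `variable` / `open` lines; statements and proofs otherwise verbatim (no renames; K's own private markers kept). `--supports stmt-Schanuel-33364`; no census credit carried; rung 0 — nothing here proves Schanuel; no ∀-item moves; 33364, 33363, 31077 stay OPEN.)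
-/

noncomputable section

open Polynomial LiouvilleNumber
open scoped Nat

namespace Summit.Schanuel.Schanuel.Theorems.RootDecomp1KArcCell

open Summit.Schanuel.Schanuel.Theorems.RootDecomp1KCollarCell
open Summit.Schanuel.Schanuel.Theorems.RootDecomp1KGapCell
open Summit.Schanuel.Schanuel.Theorems.RootDecomp1KTwoBaseCell
open Summit.Schanuel.Schanuel.Theorems.RootDecomp1KRelLiouvilleCell
open Summit.Schanuel.Schanuel.Theorems.RootDecomp1KNWMeasureHolds (polyMeasure_exp_one_holds)
open Summit.Schanuel.Schanuel.Theorems.RootDecomp1KHyper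
open Summit.Schanuel.Schanuel.Theorems.RootDecomp1KHyper.HyperCell
open Summit.Schanuel.Schanuel.Theorems.RootDecomp1KCommonRadixCell (TruncGeneric algebraicIndependent_liouville_of_truncGeneric)

/-! ## §9  (A′) THE TWIN PRODUCT `σ° = Π_{k ≥ 0} (1 + 2·4^{-k!})` — SAME skeleton, SAME denominators `4^{D_N}`, digit `2`

THE NECESSITY WITNESS FOR (E2).  For the pair `(ρ°, σ°)` the two truncation errors are COMPARABLE at every level
(`ρ° − ρ°_N ∈ [1, 8]·4^{-(N+1)!}`, `σ° − σ°_N ∈ [1, 36]·4^{-(N+1)!}`, `twin_errors_comparable`) and the two level-`N`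
approximants have the SAME denominator `4^{D_N}` with numerators of 2-adic valuation `0` and `N + 1` (`arcNum2_eq`): there is
NO dominant coordinate (the one-dominant-error criterion has nothing to work with, and its general `W`-version asks for the very
non-vanishing to be proved) and NO ultrametric weight separation (the monomials of a cleared relation collide in valuation along
anti-diagonals).  The arcs here are the LINES `T ↦ (ρ°_M (1 + T), σ°_M (1 + 2T))` through the level point, direction `(ρ°_M, 2σ°_M)`. -/
section Twin

/-- The numerator `Π_{k ≤ N} (4^{k!} + 2)` of `σ°_N` over the common denominator `4^{D_N}`. -/
def arcNum2 (N : ℕ) : ℕ := ∏ k ∈ Finset.range (N + 1), (4 ^ k ! + 2)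

/-- `arcNum2 0 = 6`. -/
theorem arcNum2_zero : arcNum2 0 = 6 := by simp [arcNum2]

/-- `(N : ℕ) : arcNum2 (N + 1) = arcNum2 N * (4 ^ (N + 1)! + 2)`. -/
theorem arcNum2_succ (N : ℕ) : arcNum2 (N + 1) = arcNum2 N * (4 ^ (N + 1)! + 2) := by
  simp only [arcNum2, Finset.prod_range_succ]

/-- `(N : ℕ) : 0 < arcNum2 N`. -/
theorem arcNum2_pos (N : ℕ) : 0 < arcNum2 N := Finset.prod_pos fun k _ => by positivity

/-- The odd part `Π_{k ≤ N} (2^{2k! − 1} + 1)` of `arcNum2 N`. -/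
def arcOdd2 (N : ℕ) : ℕ := ∏ k ∈ Finset.range (N + 1), (2 ^ (2 * Nat.factorial k - 1) + 1)

/-- `(N : ℕ) : arcOdd2 (N + 1) = arcOdd2 N * (2 ^ (2 * Nat.factorial (N + 1) - 1) + 1)`. -/
theorem arcOdd2_succ (N : ℕ) : arcOdd2 (N + 1) = arcOdd2 N * (2 ^ (2 * Nat.factorial (N + 1) - 1) + 1) := by
  simp only [arcOdd2, Finset.prod_range_succ]

/-- `(k : ℕ) : 4 ^ k ! + 2 = 2 * (2 ^ (2 * Nat.factorial k - 1) + 1)`. -/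
theorem four_pow_factorial_add_two (k : ℕ) : 4 ^ k ! + 2 = 2 * (2 ^ (2 * Nat.factorial k - 1) + 1) := by
  have hk : 1 ≤ 2 * Nat.factorial k := by have := Nat.factorial_pos k; omega
  have e : (4 : ℕ) ^ k ! = 2 * 2 ^ (2 * Nat.factorial k - 1) := by
    rw [show (4 : ℕ) = 2 ^ 2 by norm_num, ← pow_mul, ← pow_succ']
    congr 1; omega
  omega

/-- **2-adic structure of the twin numerator**: `arcNum2 N = 2^{N+1} · arcOdd2 N` with `arcOdd2 N` ODD. -/
theorem arcNum2_eq (N : ℕ) : arcNum2 N = 2 ^ (N + 1) * arcOdd2 N := by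
  induction N with
  | zero => simp [arcNum2, arcOdd2]
  | succ n ih => rw [arcNum2_succ, arcOdd2_succ, ih, four_pow_factorial_add_two, pow_succ]; ring

/-- `(N : ℕ) : Odd (arcOdd2 N)`. -/
theorem odd_arcOdd2 (N : ℕ) : Odd (arcOdd2 N) := by
  induction N with
  | zero => exact ⟨1, by simp [arcOdd2]⟩
  | succ n ih =>
    rw [arcOdd2_succ]
    refine ih.mul (Even.add_one ?_)
    refine (Nat.even_pow).mpr ⟨⟨1, rfl⟩, ?_⟩
    have := Nat.factorial_pos (n + 1)
    omega

/-- The partial products `σ°_N = Π_{k ≤ N} (1 + 2·4^{-k!}) ∈ ℚ`. -/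
def arcProdQ2 (N : ℕ) : ℚ := ∏ k ∈ Finset.range (N + 1), (1 + 2 / 4 ^ k !)

/-- `arcProdQ2 0 = 3 / 2`. -/
theorem arcProdQ2_zero : arcProdQ2 0 = 3 / 2 := by norm_num [arcProdQ2]

/-- THE RECURSION ALONG THE LINE: `σ°_{N+1} = σ°_N · (1 + 2 u_{N+1})`, `u_{N+1} = 4^{-(N+1)!}`. -/
theorem arcProdQ2_succ (N : ℕ) : arcProdQ2 (N + 1) = arcProdQ2 N * (1 + 2 / 4 ^ (N + 1)!) := by
  simp only [arcProdQ2, Finset.prod_range_succ]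

/-- `(N : ℕ) : arcProdQ2 N = (arcNum2 N : ℚ) / 4 ^ dfac N`. -/
theorem arcProdQ2_eq_div (N : ℕ) : arcProdQ2 N = (arcNum2 N : ℚ) / 4 ^ dfac N := by
  induction N with
  | zero => rw [arcProdQ2_zero, arcNum2_zero, dfac_zero]; norm_num
  | succ n ih =>
    rw [arcProdQ2_succ, ih, arcNum2_succ, dfac_succ, pow_add]
    have h4 : (4 : ℚ) ^ dfac n ≠ 0 := pow_ne_zero _ (by norm_num)
    have h4' : (4 : ℚ) ^ (n + 1)! ≠ 0 := pow_ne_zero _ (by norm_num)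
    push_cast
    field_simp

/-- `(N : ℕ) : 0 < arcProdQ2 N`. -/
theorem arcProdQ2_pos (N : ℕ) : 0 < arcProdQ2 N :=
  Finset.prod_pos fun k _ => by positivity

/-- `(N : ℕ) : arcProdQ2 N < arcProdQ2 (N + 1)`. -/
theorem arcProdQ2_lt_succ (N : ℕ) : arcProdQ2 N < arcProdQ2 (N + 1) := by
  rw [arcProdQ2_succ]
  have h1 : (1 : ℚ) < 1 + 2 / 4 ^ (N + 1)! := by
    have : (0 : ℚ) < 2 / 4 ^ (N + 1)! := by positivity
    linarith
  exact lt_mul_of_one_lt_right (arcProdQ2_pos N) h1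

/-- `StrictMono arcProdQ2`. -/
theorem arcProdQ2_strictMono : StrictMono arcProdQ2 := strictMono_nat_of_lt_succ arcProdQ2_lt_succ

/-- `Monotone arcProdQ2`. -/
theorem arcProdQ2_mono : Monotone arcProdQ2 := arcProdQ2_strictMono.monotone

/-- `(N : ℕ) : 3 / 2 ≤ arcProdQ2 N`. -/
theorem three_halves_le_arcProdQ2 (N : ℕ) : 3 / 2 ≤ arcProdQ2 N := by
  rw [← arcProdQ2_zero]; exact arcProdQ2_mono (Nat.zero_le N)

/-- `arcProdQ2 1 = 9 / 4`. -/
theorem arcProdQ2_one : arcProdQ2 1 = 9 / 4 := by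
  rw [arcProdQ2_succ, arcProdQ2_zero]; norm_num

/-- `(N : ℕ) : arcProdQ2 N * 4 ^ dfac N = arcNum2 N`. -/
theorem arcProdQ2_mul_den (N : ℕ) : arcProdQ2 N * 4 ^ dfac N = arcNum2 N := by
  rw [arcProdQ2_eq_div, div_mul_cancel₀ _ (pow_ne_zero _ (by norm_num))]

/-- `(N : ℕ) : ((arcProdQ2 N).den : ℤ) ∣ 2 ^ (2 * dfac N)`. -/
theorem den_arcProdQ2_dvd (N : ℕ) : ((arcProdQ2 N).den : ℤ) ∣ 2 ^ (2 * dfac N) := by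
  have h := Rat.den_dvd (arcNum2 N : ℤ) ((2 : ℤ) ^ (2 * dfac N))
  rw [Rat.divInt_eq_div] at h
  have e : ((arcNum2 N : ℤ) : ℚ) / (((2 : ℤ) ^ (2 * dfac N) : ℤ) : ℚ) = arcProdQ2 N := by
    rw [arcProdQ2_eq_div, pow_mul]; push_cast; norm_num
  rwa [e] at h

/-- `Π (1 + x_k) ≤ 1 + 3 Σ x_k` for non-negative `x_k` with `Σ x_k ≤ 2/3`. -/
theorem prod_one_add_le_three {ι : Type*} (s : Finset ι) (x : ι → ℝ) (hx : ∀ k, 0 ≤ x k)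
    (hs : ∑ k ∈ s, x k ≤ 2 / 3) : ∏ k ∈ s, (1 + x k) ≤ 1 + 3 * ∑ k ∈ s, x k := by
  classical
  induction s using Finset.induction_on with
  | empty => simp
  | insert a s ha ih =>
    rw [Finset.sum_insert ha] at hs ⊢
    rw [Finset.prod_insert ha]
    have hA : 0 ≤ ∑ k ∈ s, x k := Finset.sum_nonneg fun k _ => hx k
    have ih' := ih (by linarith [hx a])
    have hP : 0 ≤ ∏ k ∈ s, (1 + x k) := Finset.prod_nonneg fun k _ => by linarith [hx k]
    nlinarith [hx a, mul_le_mul_of_nonneg_left ih' (by linarith [hx a] : (0:ℝ) ≤ 1 + x a)]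

/-- Along the skeleton the twin partial products barely move: `σ°_M ≤ σ°_N (1 + 8·4^{-(N+1)!})` for `M ≥ N`. -/
theorem arcProdQ2_le_of_le {N M : ℕ} (h : N ≤ M) :
    (arcProdQ2 M : ℝ) ≤ arcProdQ2 N * (1 + 8 / 4 ^ (N + 1)!) := by
  have hsplit : (arcProdQ2 M : ℝ) = arcProdQ2 N * ∏ k ∈ Finset.Ioc N M, (1 + (2 : ℝ) / 4 ^ k !) := by
    unfold arcProdQ2
    push_cast
    have : Finset.range (M + 1) = Finset.range (N + 1) ∪ Finset.Ioc N M := by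
      ext k; simp [Finset.mem_range, Finset.mem_Ioc]; omega
    rw [this, Finset.prod_union]
    exact Finset.disjoint_left.mpr fun k hk hk' => by
      simp [Finset.mem_range, Finset.mem_Ioc] at hk hk'; omega
  rw [hsplit]
  have hpos : (0 : ℝ) < arcProdQ2 N := by exact_mod_cast arcProdQ2_pos N
  refine mul_le_mul_of_nonneg_left ?_ hpos.le
  have htail := sum_Ioc_inv_four_pow_le N M
  have htail2 : ∑ k ∈ Finset.Ioc N M, (2 : ℝ) / 4 ^ k ! ≤ 8 / 3 / 4 ^ (N + 1)! := by
    have e : ∑ k ∈ Finset.Ioc N M, (2 : ℝ) / 4 ^ k ! = 2 * ∑ k ∈ Finset.Ioc N M, (1 : ℝ) / 4 ^ k ! := by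
      rw [Finset.mul_sum]; exact Finset.sum_congr rfl fun k _ => by ring
    rw [e]
    have := mul_le_mul_of_nonneg_left htail (by norm_num : (0 : ℝ) ≤ 2)
    refine this.trans (le_of_eq ?_); ring
  have h23 : ∑ k ∈ Finset.Ioc N M, (2 : ℝ) / 4 ^ k ! ≤ 2 / 3 := by
    refine htail2.trans ?_
    have : (4 : ℝ) ≤ 4 ^ (N + 1)! := by
      calc (4 : ℝ) = 4 ^ 1 := by norm_num
        _ ≤ 4 ^ (N + 1)! := pow_le_pow_right₀ (by norm_num) (Nat.factorial_pos _)
    rw [div_le_div_iff₀ (by positivity) (by norm_num)]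
    nlinarith
  have hprod := prod_one_add_le_three (Finset.Ioc N M) (fun k => (2 : ℝ) / 4 ^ k !) (fun k => by positivity) h23
  refine hprod.trans ?_
  have : 3 * ∑ k ∈ Finset.Ioc N M, (2 : ℝ) / 4 ^ k ! ≤ 8 / 4 ^ (N + 1)! := by
    have := mul_le_mul_of_nonneg_left htail2 (by norm_num : (0 : ℝ) ≤ 3)
    refine this.trans (le_of_eq ?_); ring
  linarith

/-- A uniform bound: `σ°_M ≤ σ°_0 · 3 = 9/2 < 5`. -/
theorem arcProdQ2_le_nine_halves (M : ℕ) : (arcProdQ2 M : ℝ) ≤ 9 / 2 := by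
  have h := arcProdQ2_le_of_le (Nat.zero_le M)
  rw [arcProdQ2_zero] at h
  have : (1 : ℝ) + 8 / 4 ^ (0 + 1)! = 3 := by norm_num
  rw [this] at h
  push_cast at h
  linarith

/-- `(M : ℕ) : (arcProdQ2 M : ℝ) < 5`. -/
theorem arcProdQ2_lt_five (M : ℕ) : (arcProdQ2 M : ℝ) < 5 := by
  have := arcProdQ2_le_nine_halves M; linarith

/-- `(M : ℕ) : arcProdQ2 M < 5`. -/
theorem arcProdQ2_lt_five' (M : ℕ) : arcProdQ2 M < 5 := by exact_mod_cast arcProdQ2_lt_five M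

/-- **THE TWIN MEMBER** `σ° := sup_N σ°_N = Π_{k ≥ 0} (1 + 2·4^{-k!})`. -/
def sigmaArc : ℝ := ⨆ N : ℕ, (arcProdQ2 N : ℝ)

/-- The partial products `(σ°_N)` are bounded above (in `ℝ`). -/
theorem bddAbove_arcProdQ2 : BddAbove (Set.range fun N : ℕ => (arcProdQ2 N : ℝ)) :=
  ⟨5, by rintro _ ⟨N, rfl⟩; exact (arcProdQ2_lt_five N).le⟩

/-- `(N : ℕ) : (arcProdQ2 N : ℝ) ≤ sigmaArc`. -/
theorem arcProdQ2_le_sigmaArc (N : ℕ) : (arcProdQ2 N : ℝ) ≤ sigmaArc :=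
  le_ciSup bddAbove_arcProdQ2 N

/-- UPPER TAIL: `σ° ≤ σ°_N (1 + 8·4^{-(N+1)!})`. -/
theorem sigmaArc_le (N : ℕ) : sigmaArc ≤ arcProdQ2 N * (1 + 8 / 4 ^ (N + 1)!) := by
  refine ciSup_le fun M => ?_
  rcases le_or_gt N M with h | h
  · exact arcProdQ2_le_of_le h
  · have h1 : (arcProdQ2 M : ℝ) ≤ arcProdQ2 N := by exact_mod_cast arcProdQ2_mono h.le
    have h2 : (0 : ℝ) ≤ arcProdQ2 N * (8 / 4 ^ (N + 1)!) :=
      mul_nonneg (by exact_mod_cast (arcProdQ2_pos N).le) (by positivity)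
    linarith

/-- `0 < sigmaArc`. -/
theorem sigmaArc_pos : 0 < sigmaArc :=
  lt_of_lt_of_le (by exact_mod_cast arcProdQ2_pos 0) (arcProdQ2_le_sigmaArc 0)

/-- `9 / 4 ≤ sigmaArc`. -/
theorem nine_fourths_le_sigmaArc : 9 / 4 ≤ sigmaArc := by
  have h := arcProdQ2_le_sigmaArc 1
  rw [arcProdQ2_one] at h
  push_cast at h
  exact h

/-- `sigmaArc < 5`. -/
theorem sigmaArc_lt_five : sigmaArc < 5 := by
  have h := sigmaArc_le 1
  rw [arcProdQ2_one] at h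
  have : (8 : ℝ) / 4 ^ (1 + 1)! = 1 / 2 := by norm_num
  rw [this] at h
  push_cast at h
  linarith

/-- LOWER TAIL: `σ° − σ°_N ≥ 2σ°_N · 4^{-(N+1)!} ≥ 1/4^{(N+1)!}`. -/
theorem sigmaArc_sub_arcProdQ2_ge (N : ℕ) : 1 / 4 ^ (N + 1)! ≤ sigmaArc - arcProdQ2 N := by
  have h1 := arcProdQ2_le_sigmaArc (N + 1)
  rw [arcProdQ2_succ] at h1
  push_cast at h1
  have h32 : (3 : ℝ) / 2 ≤ arcProdQ2 N := by
    have h := (Rat.cast_le (K := ℝ)).mpr (three_halves_le_arcProdQ2 N)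
    push_cast at h
    exact h
  have hpos : (0 : ℝ) ≤ 1 / 4 ^ (N + 1)! := by positivity
  have h3 : 3 / 2 * (1 / (4 : ℝ) ^ (N + 1)!) ≤ (arcProdQ2 N : ℝ) * (1 / 4 ^ (N + 1)!) :=
    mul_le_mul_of_nonneg_right h32 hpos
  have e : (arcProdQ2 N : ℝ) * (1 + 2 / 4 ^ (N + 1)!) =
      arcProdQ2 N + 2 * ((arcProdQ2 N : ℝ) * (1 / 4 ^ (N + 1)!)) := by ring
  rw [e] at h1
  linarith

/-- UPPER TAIL in closed form: `σ° − σ°_N ≤ 36 · 4^{-(N+1)!}` (not claimed sharp). -/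
theorem sigmaArc_sub_arcProdQ2_le (N : ℕ) : sigmaArc - arcProdQ2 N ≤ 36 / 4 ^ (N + 1)! := by
  have h := sigmaArc_le N
  have h5 := arcProdQ2_le_nine_halves N
  have hpos : (0 : ℝ) ≤ 8 / 4 ^ (N + 1)! := by positivity
  rw [mul_add, mul_one] at h
  have h4 : (arcProdQ2 N : ℝ) * (8 / 4 ^ (N + 1)!) ≤ 9 / 2 * (8 / 4 ^ (N + 1)!) :=
    mul_le_mul_of_nonneg_right h5 hpos
  have e : (9 : ℝ) / 2 * (8 / 4 ^ (N + 1)!) = 36 / 4 ^ (N + 1)! := by ring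
  linarith

/-- `(N : ℕ) : (arcProdQ2 N : ℝ) < sigmaArc`. -/
theorem arcProdQ2_lt_sigmaArc (N : ℕ) : (arcProdQ2 N : ℝ) < sigmaArc := by
  have := sigmaArc_sub_arcProdQ2_ge N
  have hpos : (0 : ℝ) < 1 / 4 ^ (N + 1)! := by positivity
  linarith

/-- `(N : ℕ) : sigmaArc ≠ arcProdQ2 N`. -/
theorem sigmaArc_ne_arcProdQ2 (N : ℕ) : sigmaArc ≠ arcProdQ2 N := (arcProdQ2_lt_sigmaArc N).ne'

/-- `|σ° − σ°_N| ≤ 36 / 2^{(N+1)!}` — the dyadic-precision form used by the extraction. -/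
theorem abs_sigmaArc_sub_arcProdQ2_le (N : ℕ) : |sigmaArc - arcProdQ2 N| ≤ 36 / 2 ^ (N + 1)! := by
  rw [abs_of_pos (by linarith [arcProdQ2_lt_sigmaArc N])]
  refine (sigmaArc_sub_arcProdQ2_le N).trans ?_
  exact div_le_div_of_nonneg_left (by norm_num) (by positivity)
    (pow_le_pow_left₀ (by norm_num) (by norm_num) _)

/-- `|ρ° − ρ°_N| ≤ 36 / 2^{(N+1)!}` (the common tail constant of the twin schedule). -/
theorem abs_rhoArc_sub_arcProdQ_le' (N : ℕ) : |rhoArc - arcProdQ N| ≤ 36 / 2 ^ (N + 1)! :=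
  (abs_rhoArc_sub_arcProdQ_le N).trans (div_le_div_of_nonneg_right (by norm_num) (by positivity))

/-- **NO DOMINANT COORDINATE** (the dominance-void certificate): the two truncation errors of the twin schedule are comparable
at EVERY level, `(ρ° − ρ°_N)/8 ≤ σ° − σ°_N ≤ 36·(ρ° − ρ°_N)`. -/
theorem twin_errors_comparable (N : ℕ) :
    (rhoArc - arcProdQ N) / 8 ≤ sigmaArc - arcProdQ2 N ∧ sigmaArc - arcProdQ2 N ≤ 36 * (rhoArc - arcProdQ N) := by
  have a1 := rhoArc_sub_arcProdQ_ge N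
  have a2 := rhoArc_sub_arcProdQ_le N
  have b1 := sigmaArc_sub_arcProdQ2_ge N
  have b2 := sigmaArc_sub_arcProdQ2_le N
  have e8 : (8 : ℝ) / 4 ^ (N + 1)! = 8 * (1 / 4 ^ (N + 1)!) := by ring
  have e36 : (36 : ℝ) / 4 ^ (N + 1)! = 36 * (1 / 4 ^ (N + 1)!) := by ring
  constructor
  · linarith
  · linarith

/-- **`σ°` IS LIOUVILLE** (Mathlib `Liouville`): at `N = 2n+2`, `|σ° − arcNum2 N/4^{D_N}| ≤ 36/4^{(N+1)!} < (4^{D_N})^{−n}`. -/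
theorem liouville_sigmaArc : Liouville sigmaArc := by
  intro n
  set N : ℕ := 2 * n + 2 with hN
  have hb1 : 1 < (4 : ℤ) ^ dfac N := by exact_mod_cast Nat.one_lt_pow (dfac_pos N).ne' (by norm_num : 1 < 4)
  have e : (((arcNum2 N : ℕ) : ℤ) : ℝ) / (((4 : ℤ) ^ dfac N : ℤ) : ℝ) = ((arcProdQ2 N : ℚ) : ℝ) := by
    rw [arcProdQ2_eq_div]; push_cast; rfl
  refine ⟨(arcNum2 N : ℤ), (4 : ℤ) ^ dfac N, hb1, ?_, ?_⟩
  · rw [e]; exact sigmaArc_ne_arcProdQ2 N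
  · rw [e, abs_of_nonneg (by linarith [arcProdQ2_lt_sigmaArc N])]
    refine (sigmaArc_sub_arcProdQ2_le N).trans_lt ?_
    push_cast
    have hexp1 : dfac N * n ≤ 2 * n * N ! := by have := dfac_le N; nlinarith
    have hexp2 : 2 * n * N ! + 3 ≤ (N + 1)! := by
      have h1 : (N + 1)! = (N + 1) * N ! := Nat.factorial_succ N
      have h2 : 1 ≤ N ! := Nat.factorial_pos N
      have h3 : (N + 1) * N ! = 2 * n * N ! + 3 * N ! := by rw [hN]; ring
      linarith
    rw [div_lt_div_iff₀ (by positivity) (by positivity), one_mul, ← pow_mul]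
    calc (36 : ℝ) * 4 ^ (dfac N * n) < 64 * 4 ^ (dfac N * n) := by
          have : (0 : ℝ) < 4 ^ (dfac N * n) := by positivity
          nlinarith
      _ ≤ 64 * 4 ^ (2 * n * N !) := by gcongr; norm_num
      _ = 4 ^ (2 * n * N ! + 3) := by rw [pow_add]; norm_num; ring
      _ ≤ 4 ^ (N + 1)! := pow_le_pow_right₀ (by norm_num) hexp2

/-- `{b : ℕ} (hb : 2 ≤ b) : sigmaArc ≠ liouvilleNumber b`. -/
theorem sigmaArc_ne_liouvilleNumber {b : ℕ} (hb : 2 ≤ b) : sigmaArc ≠ liouvilleNumber b := by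
  have h1 := liouvilleNumber_le (m := (b : ℝ)) (by exact_mod_cast hb)
  have h2 := nine_fourths_le_sigmaArc
  intro h; rw [h] at h2; linarith

/-- `sigmaArc ≠ rhoArc`. -/
theorem sigmaArc_ne_rhoArc : sigmaArc ≠ rhoArc := by
  -- `ρ° ≤ ρ°_1·(1 + 1/6) = 25/16 · 7/6 < 9/4 ≤ σ°`
  have h := rhoArc_le 1
  rw [arcProdQ_one] at h
  have : (8 : ℝ) / 3 / 4 ^ (1 + 1)! = 1 / 6 := by norm_num
  rw [this] at h
  push_cast at h
  have h2 := nine_fourths_le_sigmaArc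
  intro e; rw [e] at h2; linarith

end Twin

end Summit.Schanuel.Schanuel.Theorems.RootDecomp1KArcCell

end
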